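import Literature.MathematicalPhysics.QuantumLattice.GrassmannWeightedEffectiveActionTruncationDB
import Literature.MathematicalPhysics.QuantumLattice.GrassmannEffectiveActionGradedTruncationDB
import HarnessLib

/-!
# The GRADED truncated single-scale step, DECAY-WEIGHTED, for determinant-bounded covariances
# (twin of `GrassmannEffectiveActionGradedTruncationDB` in the `wt`-weighted pinned `L¹–L^∞` norms)

Topic `MathematicalPhysics/QuantumLattice`; continuation of `GrassmannEffectiveActionGradedTruncationDB` (the graded truncated step:
orders `2 ≤ n < N₀` of `effAction C V − e^{Δ_C} V` in PRODUCT form with the leg constraint `m + 2(n−1) ≤ Σ_a 2δ_a`, the orders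
`≥ N₀` as a geometric tail) and of `GrassmannWeightedEffectiveActionTruncationDB` (the flat truncated step in the `wt`-WEIGHTED norms,
`IsTreeWeight wt`: output label sets weighted by `wt(W)`, input kernels by `wt(Y)`, covariance row and column sums by `wt{X,Y}` —
Benfatto–Giuliani–Mastropietro 2006, §3 (3.2)–(3.8), the decay bookkeeping along the spanning tree).  The two are combined VERBATIM:
the per-assignment majorisation `cumulantBound_le_indicator_prod` of the graded file is weight-free and is reused, the weighted
per-assignment cumulant bound is `GrassmannWeightedCumulantBoundDB.sum_wt_norm_kernel_cumulantOf_le_of_gramBounded`, and the weighted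
flat tail is `GrassmannWeightedEffectiveActionTruncationDB.sum_wt_norm_kernel_effAction_add_sum_cumulant_le_of_gramBounded`:

* `sum_wt_norm_kernel_cumulantOf_le_graded_of_gramBounded` — `Σ_{W : W_i = w} wt(W) ‖kernel_r 𝓔ᵀ_C(V; n)(W)‖ ≤
  n! · ρ^{-r} κ^{-2(n−1)} α^{n−1} eⁿ · Σ_{δ : r + 2(n−1) ≤ Σ 2δ_a} Π_a (e²(κ+ρ))^{2δ_a} N(δ_a)` (weighted anchored norms `N`, weighted
  row / column sums `α`);
* **`sum_wt_norm_kernel_effAction_sub_gaussConv_le_graded_of_gramBounded`** — with `θ = eα‖V‖_{h,wt}/κ² < 1`, for every `N₀ ≥ 2` and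
  every degree `m ≥ 1`, one output label pinned and the output label set weighted,
  `Σ_{W : W_i = w} wt(W) ‖kernel_m (effAction C V − e^{Δ_C}V)(W)‖ ≤
     Σ_{n=2}^{N₀−1} ρ^{-m} κ^{-2(n−1)} α^{n−1} eⁿ · Σ_{δ ∈ [0,|Γ|/2]^n, m + 2(n−1) ≤ Σ 2δ_a} Π_a (e²(κ+ρ))^{2δ_a} N(δ_a)
       + ρ^{-m} e‖V‖_{h,wt} θ^{N₀−1}/(1−θ)`;
* `sum_wt_norm_kernel_effAction_sub_gaussConv_le_graded_kappa_of_gramBounded` — the same at `ρ = κ` in degree `m = 2p` with the leg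
  constraint halved (`p + (n−1) ≤ Σ_a δ_a`) and the prefactor written `e · (eα/κ²)^{n−1} · κ^{-2p}` (the currency of a graded tower).

Wanted by the weighted kernel profile of the K3 engine of the cell gate-hubbard-kl in the degrees `m ≥ 6` (stub (b) of
stmt-HubbardSuperconductivity-20437; the unweighted graded file is supplier G1 of the blocked-tower bookkeeping): the leg constraint is what
carries the perturbative order `λ^{p−1}` of the degree-`2p` kernel, the tree weight what carries the decay.

Everything is proved; no definition, no named fact.

## Sources

G. Benfatto, A. Giuliani, V. Mastropietro, Ann. Henri Poincaré 7 (2006) 809–898: (2.13)–(2.14) (truncated expectations), (2.16) with (2.82) (the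
printed order `|U|^{max{1,l/2}}` of the `2l`-leg kernels), (2.61)–(2.63) (the single-scale step as `Σ_n 𝓔ᵀ(·; n)/n!`), (2.77)–(2.80) (the `n!`
bound), §3 (3.2)–(3.8) (decay bookkeeping along the spanning tree) [`BenfattoGiulianiMastropietro2006`]; W. de Siqueira Pedra, M. Salmhofer, Comm. Math. Phys. 282 (2008) 797–818, Thm 2.4
[`PedraSalmhofer2008`]; K. Gawȩdzki, A. Kupiainen, Comm. Math. Phys. 102 (1985) 1–30, §3 [`GawedzkiKupiainen1985GrossNeveu`].
-/

noncomputable section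

namespace Literature.MathematicalPhysics.QuantumLattice

open GrassmannAlgebra Finset Literature.Probability.LatticeModels Literature.Probability.LatticeModels.BattleFederbush
open scoped InnerProductSpace Nat

universe u

variable {𝕜 : Type*} [RCLike 𝕜] {Γ : Type u} [Fintype Γ] [DecidableEq Γ] {n : ℕ} {wt : Finset Γ → ℝ} (C : Matrix Γ Γ 𝕜)

/-! ### The weighted graded cumulant bound -/

/-- (Weighted twin of `sum_norm_kernel_cumulantOf_le_graded_of_gramBounded`.) **The graded, decay-weighted `L¹–L^∞` bound for the
kernels of `𝓔ᵀ_C(V; n)`** (`sum_wt_norm_kernel_cumulantOf_le_of_gramBounded` with `λ_δ = 1/(α(N_δ+n))` and the weight-free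
`cumulantBound_le_indicator_prod`, the leg constraint KEPT; Benfatto–Giuliani–Mastropietro 2006, (2.13)–(2.14) with (2.77)–(2.80) and the
decay bookkeeping of §3 (3.2)–(3.8)): for a tree weight `wt`, `V = Σ_{m' ∈ degs} Σ_Y K_{m'}(Y) ψ(Y)` with `wt`-weighted anchored `L¹`
norms `≤ N(m')`, a covariance replica-stably Gram-bounded with constant `κ > 0` (`IsGramBoundedR`), one-copy row and column sums of
`‖C(X,Y)‖ wt{X,Y}` at most `α > 0`, an output weight `ρ > 0`, one output label pinned and the output label set weighted:
`Σ_{W : W_i = w} wt(W) ‖kernel_r 𝓔ᵀ_C(V; n)(W)‖ ≤ n! · ρ^{-r} κ^{-2(n−1)} α^{n−1} eⁿ · Σ_{δ : r + 2(n−1) ≤ Σ_a 2δ_a} Π_a (e²(κ+ρ))^{2δ_a} N(δ_a)`.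
[cite: BenfattoGiulianiMastropietro2006, (2.13)-(2.14), (2.77)-(2.80) and §3 (3.2)-(3.8)] -/
theorem sum_wt_norm_kernel_cumulantOf_le_graded_of_gramBounded (hwt : IsTreeWeight wt) {κ : ℝ} (hκ : 0 < κ)
    (hGB : IsGramBoundedR C κ)
    (degs : Finset ℕ) (K : (m' : ℕ) → (Fin (2 * m') → Γ) → 𝕜) (N : ℕ → ℝ) (hN0 : ∀ m', 0 ≤ N m')
    (hN : ∀ m' (j : Fin (2 * m')) (w : Γ), ∑ Y ∈ univ.filter (fun Y : Fin (2 * m') → Γ => Y j = w),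
      ‖K m' Y‖ * wt (univ.image Y) ≤ N m')
    {α : ℝ} (hα : 0 < α) (hrow : ∀ X, ∑ Y, ‖C X Y‖ * wt {X, Y} ≤ α) (hcol : ∀ Y, ∑ X, ‖C X Y‖ * wt {X, Y} ≤ α) {ρ : ℝ} (hρ : 0 < ρ)
    (hn : 0 < n) {r : ℕ} (i : Fin r) (w : Γ) :
    ∑ W ∈ univ.filter (fun W : Fin r → Γ => W i = w), wt (univ.image W) *
        ‖kernel 𝕜 ((cumulantOf (fun k => evenGaussConv 𝕜 C (vertexOf 𝕜 degs K ^ k)) n : evenPart 𝕜 Γ) : GrassmannAlgebra 𝕜 Γ) r W‖ ≤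
      (n ! : ℝ) * (ρ⁻¹ ^ r * κ⁻¹ ^ (2 * (n - 1)) * (α ^ (n - 1) * Real.exp n)) *
        ∑ δ ∈ (Fintype.piFinset fun _ : Fin n => degs) with r + 2 * (n - 1) ≤ ∑ a, 2 * δ a,
          ∏ a, (Real.exp 2 * (κ + ρ)) ^ (2 * δ a) * N (δ a) := by
  have h := sum_wt_norm_kernel_cumulantOf_le_of_gramBounded C hwt hκ.le hGB degs K N hN0 hN hα.le hrow hcol
    (fun δ => (α * ((∑ a, (2 * δ a : ℝ)) + n))⁻¹) (fun δ => by positivity) hn i w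
  refine h.trans ?_
  set c : ℝ := ρ⁻¹ ^ r * κ⁻¹ ^ (2 * (n - 1)) * (((n - 1)! : ℝ) * α ^ (n - 1) * Real.exp n) with hc
  rw [← sum_filter]
  calc (n : ℝ) * ∑ δ ∈ (Fintype.piFinset fun _ : Fin n => degs) with r + 2 * (n - 1) ≤ ∑ a, 2 * δ a,
          cumulantBound n κ α ((α * ((∑ a, (2 * δ a : ℝ)) + n))⁻¹) N r δ
      ≤ (n : ℝ) * ∑ δ ∈ (Fintype.piFinset fun _ : Fin n => degs) with r + 2 * (n - 1) ≤ ∑ a, 2 * δ a,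
          c * ∏ a, (Real.exp 2 * (κ + ρ)) ^ (2 * δ a) * N (δ a) :=
        mul_le_mul_of_nonneg_left (sum_le_sum fun δ hδ =>
          cumulantBound_le_indicator_prod hκ hα hρ hn N hN0 r δ (mem_filter.1 hδ).2) (Nat.cast_nonneg n)
    _ = (n ! : ℝ) * (ρ⁻¹ ^ r * κ⁻¹ ^ (2 * (n - 1)) * (α ^ (n - 1) * Real.exp n)) *
          ∑ δ ∈ (Fintype.piFinset fun _ : Fin n => degs) with r + 2 * (n - 1) ≤ ∑ a, 2 * δ a,
            ∏ a, (Real.exp 2 * (κ + ρ)) ^ (2 * δ a) * N (δ a) := by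
        rw [← mul_sum, hc, ← Nat.mul_factorial_pred (Nat.pos_iff_ne_zero.1 hn), Nat.cast_mul]
        ring

/-! ### The weighted graded truncated step -/

/-- (Weighted twin of `sum_norm_kernel_effAction_sub_gaussConv_le_graded_of_gramBounded`.) **The non-linear part of the
renormalisation-group map, GRADED, with decay** (Benfatto–Giuliani–Mastropietro 2006: the single-scale step as the cumulant expansion
`Σ_n 𝓔ᵀ(·; n)/n!` (2.13)–(2.14), (2.61)–(2.63), bounded by (2.77)–(2.80) with the decay bookkeeping of §3 (3.2)–(3.8); Gawȩdzki–Kupiainen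
1985, §3): for a tree weight `wt`, with `θ = eα‖V‖_h/κ² < 1` (weighted norms,
`‖V‖_h = Σ_{m' ≤ |Γ|/2} (e²(κ+ρ))^{2m'} N(m')`), for every `N₀ ≥ 2` and every degree `m ≥ 1`, one output label pinned and the output label set
weighted,
`Σ_{W : W_i = w} wt(W) ‖kernel_m (effAction C V − e^{Δ_C} V)(W)‖ ≤
   Σ_{n=2}^{N₀−1} ρ^{-m} κ^{-2(n−1)} α^{n−1} eⁿ · Σ_{δ ∈ [0,|Γ|/2]^n, m + 2(n−1) ≤ Σ_a 2δ_a} Π_a (e²(κ+ρ))^{2δ_a} N(δ_a) + ρ^{-m} e‖V‖_h θ^{N₀−1}/(1−θ)`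
— the cumulants of orders `2 … N₀−1` in product form with the leg constraint, the orders `≥ N₀` as the geometric tail of
`sum_wt_norm_kernel_effAction_add_sum_cumulant_le_of_gramBounded`.
[cite: BenfattoGiulianiMastropietro2006, (2.13)-(2.14), (2.61)-(2.63), (2.77)-(2.80) and §3 (3.2)-(3.8)] -/
theorem sum_wt_norm_kernel_effAction_sub_gaussConv_le_graded_of_gramBounded (hwt : IsTreeWeight wt) {κ : ℝ} (hκ : 0 < κ)
    (hGB : IsGramBoundedR C κ)
    (V : GrassmannAlgebra 𝕜 Γ) (hV : V ∈ evenPart 𝕜 Γ) (hV0 : constPart 𝕜 V = 0) (N : ℕ → ℝ) (hN0 : ∀ m', 0 ≤ N m')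
    (hN : ∀ m' (j : Fin (2 * m')) (w : Γ), ∑ Y ∈ univ.filter (fun Y : Fin (2 * m') → Γ => Y j = w),
      ‖kernel 𝕜 V (2 * m') Y‖ * wt (univ.image Y) ≤ N m')
    {α : ℝ} (hα : 0 < α) (hrow : ∀ X, ∑ Y, ‖C X Y‖ * wt {X, Y} ≤ α) (hcol : ∀ Y, ∑ X, ‖C X Y‖ * wt {X, Y} ≤ α) {ρ : ℝ} (hρ : 0 < ρ)
    (hθ : Real.exp 1 * α * normV Γ κ ρ N / κ ^ 2 < 1) {N₀ : ℕ} (hN₀ : 2 ≤ N₀) {m : ℕ} (hm : 0 < m) (i : Fin m) (w : Γ) :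
    ∑ W ∈ univ.filter (fun W : Fin m → Γ => W i = w), wt (univ.image W) * ‖kernel 𝕜 (effAction 𝕜 C V - gaussConv 𝕜 C V) m W‖ ≤
      ∑ n ∈ Ico 2 N₀, (ρ⁻¹ ^ m * κ⁻¹ ^ (2 * (n - 1)) * (α ^ (n - 1) * Real.exp n)) *
          ∑ δ ∈ (Fintype.piFinset fun _ : Fin n => range (Fintype.card Γ / 2 + 1)) with m + 2 * (n - 1) ≤ ∑ a, 2 * δ a,
            ∏ a, (Real.exp 2 * (κ + ρ)) ^ (2 * δ a) * N (δ a) +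
        ρ⁻¹ ^ m * (Real.exp 1 * normV Γ κ ρ N) *
          (Real.exp 1 * α * normV Γ κ ρ N / κ ^ 2) ^ (N₀ - 1) / (1 - Real.exp 1 * α * normV Γ κ ρ N / κ ^ 2) := by
  -- notation (as in `sum_wt_norm_kernel_effAction_add_sum_cumulant_le_of_gramBounded`)
  set X : evenPart 𝕜 Γ := ⟨-V, neg_mem hV⟩ with hX
  set degs : Finset ℕ := range (Fintype.card Γ / 2 + 1) with hdegs
  set K : (m' : ℕ) → (Fin (2 * m') → Γ) → 𝕜 := fun m' => kernel 𝕜 (-V) (2 * m') with hK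
  have hXv : vertexOf 𝕜 degs K = X := Subtype.ext (coe_vertexOf_kernel_eq 𝕜 X)
  have hN' : ∀ (m' : ℕ) (j : Fin (2 * m')) (w : Γ), ∑ Y ∈ univ.filter (fun Y : Fin (2 * m') → Γ => Y j = w),
      ‖K m' Y‖ * wt (univ.image Y) ≤ N m' := by
    intro m' j w
    have hKnorm : ∀ Y : Fin (2 * m') → Γ, ‖K m' Y‖ = ‖kernel 𝕜 V (2 * m') Y‖ := fun Y => by
      rw [hK]
      dsimp only
      rw [show -V = (-1 : 𝕜) • V from (neg_one_smul 𝕜 V).symm, kernel_smul, norm_mul, norm_neg, norm_one, one_mul]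
    simp only [hKnorm]
    exact hN m' j w
  set κs : ℕ → evenPart 𝕜 Γ := fun n => cumulantOf (fun k => evenGaussConv 𝕜 C (X ^ k)) n with hκs
  have hκs_eq : ∀ n, κs n = cumulantOf (fun k => evenGaussConv 𝕜 C (vertexOf 𝕜 degs K ^ k)) n := fun n => by rw [hXv]
  -- the weighted flat tail at order `N₀`
  obtain ⟨-, hbd⟩ := sum_wt_norm_kernel_effAction_add_sum_cumulant_le_of_gramBounded C hwt hκ hGB V hV hV0 N hN0 hN hα
    hrow hcol hρ hθ (n₀ := N₀) (by omega)
  have htail := hbd hm i w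
  -- the weighted graded bound of one cumulant term, with the `1/n!`
  set G : ℕ → ℝ := fun n => (ρ⁻¹ ^ m * κ⁻¹ ^ (2 * (n - 1)) * (α ^ (n - 1) * Real.exp n)) *
      ∑ δ ∈ (Fintype.piFinset fun _ : Fin n => degs) with m + 2 * (n - 1) ≤ ∑ a, 2 * δ a,
        ∏ a, (Real.exp 2 * (κ + ρ)) ^ (2 * δ a) * N (δ a) with hG
  have hterm : ∀ n, 0 < n → ∑ W ∈ univ.filter (fun W : Fin m → Γ => W i = w),
      wt (univ.image W) * ‖((n ! : 𝕜))⁻¹ * kernel 𝕜 ((κs n : evenPart 𝕜 Γ) : GrassmannAlgebra 𝕜 Γ) m W‖ ≤ G n := by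
    intro n hn
    have h := sum_wt_norm_kernel_cumulantOf_le_graded_of_gramBounded C hwt hκ hGB degs K N hN0 hN' hα hrow hcol hρ hn i w
    rw [← hκs_eq] at h
    have hfac : (0 : ℝ) < n ! := by positivity
    calc ∑ W ∈ univ.filter (fun W : Fin m → Γ => W i = w),
          wt (univ.image W) * ‖((n ! : 𝕜))⁻¹ * kernel 𝕜 ((κs n : evenPart 𝕜 Γ) : GrassmannAlgebra 𝕜 Γ) m W‖
        = (n ! : ℝ)⁻¹ * ∑ W ∈ univ.filter (fun W : Fin m → Γ => W i = w),
            wt (univ.image W) * ‖kernel 𝕜 ((κs n : evenPart 𝕜 Γ) : GrassmannAlgebra 𝕜 Γ) m W‖ := by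
          rw [mul_sum]
          exact sum_congr rfl fun W _ => by rw [norm_mul, norm_inv, RCLike.norm_natCast]; ring
      _ ≤ (n ! : ℝ)⁻¹ * ((n ! : ℝ) * (ρ⁻¹ ^ m * κ⁻¹ ^ (2 * (n - 1)) * (α ^ (n - 1) * Real.exp n)) *
            ∑ δ ∈ (Fintype.piFinset fun _ : Fin n => degs) with m + 2 * (n - 1) ≤ ∑ a, 2 * δ a,
              ∏ a, (Real.exp 2 * (κ + ρ)) ^ (2 * δ a) * N (δ a)) :=
          mul_le_mul_of_nonneg_left h (by positivity)
      _ = G n := by rw [hG]; field_simp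
  -- the algebra: `kernel (effAction - e^{Δ}V) = [kernel effAction + Σ_{1 ≤ n < N₀} (n!)⁻¹ kernel κ_n] - Σ_{2 ≤ n < N₀} (n!)⁻¹ kernel κ_n`
  have hone : ∀ W, ((1 ! : 𝕜))⁻¹ * kernel 𝕜 ((κs 1 : evenPart 𝕜 Γ) : GrassmannAlgebra 𝕜 Γ) m W = -kernel 𝕜 (gaussConv 𝕜 C V) m W := by
    intro W
    rw [hκs]
    dsimp only
    rw [Nat.factorial_one, Nat.cast_one, inv_one, one_mul, cumulantOf_one]
    simp only [pow_one, coe_evenGaussConv, hX, map_neg]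
    rw [show -gaussConv 𝕜 C V = (-1 : 𝕜) • gaussConv 𝕜 C V from (neg_one_smul 𝕜 _).symm, kernel_smul]
    ring
  have hsplit : ∀ W, kernel 𝕜 (effAction 𝕜 C V - gaussConv 𝕜 C V) m W =
      (kernel 𝕜 (effAction 𝕜 C V) m W + ∑ n ∈ Ico 1 N₀, ((n ! : 𝕜))⁻¹ * kernel 𝕜 ((κs n : evenPart 𝕜 Γ) : GrassmannAlgebra 𝕜 Γ) m W) -
        ∑ n ∈ Ico 2 N₀, ((n ! : 𝕜))⁻¹ * kernel 𝕜 ((κs n : evenPart 𝕜 Γ) : GrassmannAlgebra 𝕜 Γ) m W := by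
    intro W
    rw [sum_eq_sum_Ico_succ_bot (by omega : 1 < N₀), show ((1 ! : 𝕜))⁻¹ * kernel 𝕜 ((κs 1 : evenPart 𝕜 Γ) : GrassmannAlgebra 𝕜 Γ) m W =
      -kernel 𝕜 (gaussConv 𝕜 C V) m W from hone W,
      show effAction 𝕜 C V - gaussConv 𝕜 C V = effAction 𝕜 C V + (-1 : 𝕜) • gaussConv 𝕜 C V by rw [neg_one_smul, sub_eq_add_neg],
      kernel_add, kernel_smul]
    ring
  -- assemble (the weight `wt(W) ≥ 0` multiplies the splitting inequality termwise)
  calc ∑ W ∈ univ.filter (fun W : Fin m → Γ => W i = w), wt (univ.image W) * ‖kernel 𝕜 (effAction 𝕜 C V - gaussConv 𝕜 C V) m W‖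
      ≤ ∑ W ∈ univ.filter (fun W : Fin m → Γ => W i = w),
          (wt (univ.image W) *
              ‖kernel 𝕜 (effAction 𝕜 C V) m W + ∑ n ∈ Ico 1 N₀, ((n ! : 𝕜))⁻¹ * kernel 𝕜 ((κs n : evenPart 𝕜 Γ) : GrassmannAlgebra 𝕜 Γ) m W‖ +
            ∑ n ∈ Ico 2 N₀, wt (univ.image W) * ‖((n ! : 𝕜))⁻¹ * kernel 𝕜 ((κs n : evenPart 𝕜 Γ) : GrassmannAlgebra 𝕜 Γ) m W‖) :=
        sum_le_sum fun W _ => by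
          rw [hsplit W, ← mul_sum, ← mul_add]
          exact mul_le_mul_of_nonneg_left ((norm_sub_le _ _).trans (add_le_add le_rfl (norm_sum_le _ _))) (hwt.nonneg _)
    _ = ∑ W ∈ univ.filter (fun W : Fin m → Γ => W i = w), wt (univ.image W) *
          ‖kernel 𝕜 (effAction 𝕜 C V) m W + ∑ n ∈ Ico 1 N₀, ((n ! : 𝕜))⁻¹ * kernel 𝕜 ((κs n : evenPart 𝕜 Γ) : GrassmannAlgebra 𝕜 Γ) m W‖ +
          ∑ n ∈ Ico 2 N₀, ∑ W ∈ univ.filter (fun W : Fin m → Γ => W i = w),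
            wt (univ.image W) * ‖((n ! : 𝕜))⁻¹ * kernel 𝕜 ((κs n : evenPart 𝕜 Γ) : GrassmannAlgebra 𝕜 Γ) m W‖ := by
        rw [sum_add_distrib, sum_comm]
    _ ≤ ρ⁻¹ ^ m * (Real.exp 1 * normV Γ κ ρ N) *
          (Real.exp 1 * α * normV Γ κ ρ N / κ ^ 2) ^ (N₀ - 1) / (1 - Real.exp 1 * α * normV Γ κ ρ N / κ ^ 2) +
          ∑ n ∈ Ico 2 N₀, G n :=
        add_le_add htail (sum_le_sum fun n hn => hterm n (by have := (mem_Ico.1 hn).1; omega))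
    _ = _ := by rw [hG, add_comm]

/-! ### The form a graded tower reads: output weight `ρ = κ`, degree `2p`, halved leg constraint -/

/-- The leg constraint in halved form: `2p + 2(n−1) ≤ Σ_a 2δ_a ↔ p + (n−1) ≤ Σ_a δ_a` (arithmetic plumbing). [folklore] -/
private theorem two_mul_add_le_sum_two_mul_iff (δ : Fin n → ℕ) (p : ℕ) :
    2 * p + 2 * (n - 1) ≤ ∑ a, 2 * δ a ↔ p + (n - 1) ≤ ∑ a, δ a := by
  rw [← mul_sum]
  omega

/-- (Corollary of `sum_wt_norm_kernel_effAction_sub_gaussConv_le_graded_of_gramBounded` at `ρ = κ`, `m = 2p`.) **The weighted graded step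
in the currency of a graded tower** (Benfatto–Giuliani–Mastropietro 2006, (2.13)–(2.14) with (2.77)–(2.80) and §3 (3.2)–(3.8); the leg
constraint — `n − 1` lines of a connecting tree and `p` surviving leg pairs force `Σ_a δ_a ≥ p + n − 1` — is what the theorem itself carries,
and for a quartic interaction it makes the degree-`2p` kernel of order `p − 1` in the coupling, cf. the printed order statement (2.16) with
(2.82)): with
`Φ = eα/κ²`, `ψ = κ⁻²`, `θ = Φ‖V‖_{h,wt} < 1` (`‖V‖_{h,wt} = normV Γ κ κ N`, weighted anchored norms `N`), for every `N₀ ≥ 2` and `p ≥ 1`, one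
output label pinned and the output label set weighted,
`Σ_{W : W_i = w} wt(W) ‖kernel_{2p} (effAction C V − e^{Δ_C} V)(W)‖ ≤
   Σ_{n=2}^{N₀−1} e · Φ^{n−1} · ψ^p · Σ_{δ ∈ [0,|Γ|/2]^n, p + (n−1) ≤ Σ_a δ_a} Π_a (e²·2κ)^{2δ_a} N(δ_a) + ψ^p · e‖V‖_{h,wt} · θ^{N₀−1}/(1−θ)`.
[cite: BenfattoGiulianiMastropietro2006, (2.13)-(2.14), (2.77)-(2.80) and §3 (3.2)-(3.8)] -/
theorem sum_wt_norm_kernel_effAction_sub_gaussConv_le_graded_kappa_of_gramBounded (hwt : IsTreeWeight wt) {κ : ℝ} (hκ : 0 < κ)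
    (hGB : IsGramBoundedR C κ)
    (V : GrassmannAlgebra 𝕜 Γ) (hV : V ∈ evenPart 𝕜 Γ) (hV0 : constPart 𝕜 V = 0) (N : ℕ → ℝ) (hN0 : ∀ m', 0 ≤ N m')
    (hN : ∀ m' (j : Fin (2 * m')) (w : Γ), ∑ Y ∈ univ.filter (fun Y : Fin (2 * m') → Γ => Y j = w),
      ‖kernel 𝕜 V (2 * m') Y‖ * wt (univ.image Y) ≤ N m')
    {α : ℝ} (hα : 0 < α) (hrow : ∀ X, ∑ Y, ‖C X Y‖ * wt {X, Y} ≤ α) (hcol : ∀ Y, ∑ X, ‖C X Y‖ * wt {X, Y} ≤ α)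
    (hθ : Real.exp 1 * α * normV Γ κ κ N / κ ^ 2 < 1) {N₀ : ℕ} (hN₀ : 2 ≤ N₀) {p : ℕ} (hp : 0 < p) (i : Fin (2 * p)) (w : Γ) :
    ∑ W ∈ univ.filter (fun W : Fin (2 * p) → Γ => W i = w), wt (univ.image W) *
        ‖kernel 𝕜 (effAction 𝕜 C V - gaussConv 𝕜 C V) (2 * p) W‖ ≤
      ∑ n ∈ Ico 2 N₀, Real.exp 1 * (Real.exp 1 * α / κ ^ 2) ^ (n - 1) * κ⁻¹ ^ (2 * p) *
          ∑ δ ∈ (Fintype.piFinset fun _ : Fin n => range (Fintype.card Γ / 2 + 1)) with p + (n - 1) ≤ ∑ a, δ a,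
            ∏ a, (Real.exp 2 * (κ + κ)) ^ (2 * δ a) * N (δ a) +
        κ⁻¹ ^ (2 * p) * (Real.exp 1 * normV Γ κ κ N) *
          (Real.exp 1 * α * normV Γ κ κ N / κ ^ 2) ^ (N₀ - 1) / (1 - Real.exp 1 * α * normV Γ κ κ N / κ ^ 2) := by
  refine (sum_wt_norm_kernel_effAction_sub_gaussConv_le_graded_of_gramBounded C hwt hκ hGB V hV hV0 N hN0 hN hα hrow hcol hκ hθ
    hN₀ (by omega) i w).trans (le_of_eq ?_)
  congr 1
  refine sum_congr rfl fun n hn => ?_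
  -- the prefactor `κ^{-2p} κ^{-2(n−1)} α^{n−1} eⁿ = e · (eα/κ²)^{n−1} · κ^{-2p}`
  have hpre : κ⁻¹ ^ (2 * p) * κ⁻¹ ^ (2 * (n - 1)) * (α ^ (n - 1) * Real.exp n) =
      Real.exp 1 * (Real.exp 1 * α / κ ^ 2) ^ (n - 1) * κ⁻¹ ^ (2 * p) := by
    obtain ⟨k, rfl⟩ : ∃ k, n = k + 1 := ⟨n - 1, by have := (mem_Ico.1 hn).1; omega⟩
    rw [Nat.add_sub_cancel, show ((k + 1 : ℕ) : ℝ) = (k : ℝ) + 1 by push_cast; ring, Real.exp_add,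
      show Real.exp (k : ℝ) = Real.exp 1 ^ k by rw [← Real.exp_nat_mul, mul_one], div_pow, mul_pow, ← pow_mul, div_eq_mul_inv,
      ← inv_pow]
    ring
  rw [hpre, filter_congr fun δ _ => two_mul_add_le_sum_two_mul_iff δ p]

end Literature.MathematicalPhysics.QuantumLattice

end
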